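import Summits.ValiantsHypothesis.ValiantsHypothesis.Theorems.EquivariantDialPairAlgebra
import Literature.AlgebraicGeometry.DeterminantalHypersurfaces.KernerVinnikovGlobal
import HarnessLib

/-!
# Idempotent splitting of the intertwiner pair algebra
(support of `CollapseToVPws`, stmt-ValiantsHypothesis-23702; road to `LocalShrinking`, part 1/3)

Honest scope.  This file is NOT a route and closes NO item.  VP ≠ VNP is NOT proved here and
nothing below is progress on it; 0 S-currency.  Cell A (`EqHardBiPerm`) is NOT proved in this
file: it only supplies the linear algebra used by parts 2/3 (`EquivariantDialCornerDescent`,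
`EquivariantDialLocalShrinking`) on the road to the working residual
`EquivariantDialFiniteSupplement.LocalShrinking`.

## Contents (Fitting's lemma for the intertwiner pair algebra, in matrix form)

* `exists_idempotent_of_not_local` — in a finite-dimensional algebra `E` over an algebraically
  closed field, an element `y` of a subalgebra `S` none of whose scalar shifts `y - μ` is
  nilpotent yields an idempotent `e ∈ S` with `e ≠ 0, 1`: a Bézout combination in `k[y]`
  separating the `μ`-primary factor of the minimal polynomial of `y`.
* `exists_idempotent_mem_pairAlg` — hence a matrix whose intertwiner pair algebra `pairAlg N`
  is not local (`¬ IsLocalRepr N`) has an idempotent intertwiner pair `e ≠ 0, 1`.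
* `trace_fst_eq_trace_snd` — for `det N ≠ 0` the two components of an intertwiner pair have
  equal traces (`adj N · C(e.1) · N = det N · C(e.2)`).
* `eq_conj_of_inv_mul_mul_eq` — bookkeeping: `T⁻¹ x T = y → x = T y T⁻¹`.
* `exists_blockDiagonal_of_idempotent` — an idempotent intertwiner pair `e ≠ 0, 1` whose
  components have equal traces splits `N`, up to constant invertible left/right factors, into a
  block sum `X₁ ⊕ X₂` of positive sizes `q, q'` (`q + q' = d`).  The block bookkeeping follows
  `KernerVinnikovGlobal` (each component is conjugated to `𝟙 ⊕ 0` by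
  `KernerVinnikovBlocks.exists_conj_eq_fromBlocks_of_idempotent`; the two conjugated
  projectors then commute with the transformed matrix, killing its off-diagonal blocks).

Classical mathematics (Fitting's lemma / the Krull–Schmidt exchange for matrix pencils under
left-right equivalence); no Literature fact is used as a hypothesis.

Labels (critic K5, CALL 2298).  Restricted-model lower bound, inside the equivariance barrier
(this part is the linear algebra feeding it); 0 S-currency; closes NO item;
`DcPerSuperpolynomial` / VP ≠ VNP untouched.  Non-vacuity (K6): the hypotheses of
`exists_blockDiagonal_of_idempotent` are met by the non-local pencil `N = diag(x, 1)` (`2 × 2`,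
`det N = x` prime, intertwiner pair `e = (E₁₁, E₁₁)` idempotent, `e ≠ 0, 1`, equal traces),
which it splits as `(x) ⊕ (1)`.
-/

set_option linter.dupNamespace false

namespace Summit.ValiantsHypothesis.ValiantsHypothesis.Theorems.EquivariantDialIdempotentSplitting

noncomputable section

section Idempotent

open Polynomial

variable {k E : Type*} [Field k] [Ring E] [Algebra k E]

/-- (Fitting, scalar form) In a finite-dimensional algebra over an algebraically closed field, an
element `y` of a subalgebra `S` such that no `y - μ` (`μ` a scalar) is nilpotent produces an
idempotent `e ∈ S` different from `0` and `1`: write the minimal polynomial of `y` as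
`(X - μ)ⁿ g` with `g(μ) ≠ 0`, choose `a (X - μ)ⁿ + b g = 1` and put `e := (b g)(y)`. -/
theorem exists_idempotent_of_not_local [IsAlgClosed k] [FiniteDimensional k E]
    (S : Subalgebra k E) {y : E} (hy : y ∈ S)
    (hnl : ∀ μ : k, ¬ IsNilpotent (y - algebraMap k E μ)) :
    ∃ e ∈ S, IsIdempotentElem e ∧ e ≠ 0 ∧ e ≠ 1 := by
  obtain hE | hE := subsingleton_or_nontrivial E
  · refine (hnl 0 ?_).elim
    rw [Subsingleton.elim (y - algebraMap k E 0) 0]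
    exact IsNilpotent.zero
  have hint : IsIntegral k y := IsIntegral.of_finite k y
  have hp0 : minpoly k y ≠ 0 := minpoly.ne_zero hint
  obtain ⟨μ, hμ⟩ := IsAlgClosed.exists_root (minpoly k y) (minpoly.degree_pos hint).ne'
  obtain ⟨g, hpg, hndvd⟩ := (minpoly k y).exists_eq_pow_rootMultiplicity_mul_and_not_dvd hp0 μ
  have hn0 : 0 < (minpoly k y).rootMultiplicity μ := (rootMultiplicity_pos hp0).mpr hμ
  generalize hn : (minpoly k y).rootMultiplicity μ = n at hpg hn0
  obtain ⟨a, b, hab⟩ : IsCoprime ((X - C μ) ^ n) g :=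
    ((irreducible_X_sub_C μ).coprime_iff_not_dvd.mpr hndvd).pow_left
  have hroot : aeval y (minpoly k y) = 0 := minpoly.aeval k y
  have hPg : aeval y ((X - C μ) ^ n) * aeval y g = 0 := by rw [← map_mul, ← hpg, hroot]
  have hab' : aeval y a * aeval y ((X - C μ) ^ n) + aeval y (b * g) = 1 := by
    rw [← map_mul, ← map_add, hab, map_one]
  have hPy : aeval y ((X - C μ) ^ n) = (y - algebraMap k E μ) ^ n := by
    rw [map_pow, map_sub, aeval_X, aeval_C]
  refine ⟨aeval y (b * g), ?_, ?_, ?_, ?_⟩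
  · have h2 : (aeval (⟨y, hy⟩ : S) (b * g) : E) = aeval y (b * g) :=
      aeval_subalgebra_coe (b * g) S ⟨y, hy⟩
    rw [← h2]
    exact (aeval (⟨y, hy⟩ : S) (b * g)).2
  · have h1e : aeval y a * aeval y ((X - C μ) ^ n) = 1 - aeval y (b * g) :=
      eq_sub_of_add_eq hab'
    have hz : aeval y (b * g) * (1 - aeval y (b * g)) = 0 := by
      rw [← h1e, ← map_mul, ← map_mul,
        show b * g * (a * (X - C μ) ^ n) = b * a * ((X - C μ) ^ n * g) from by ring, map_mul,
        ← hpg, hroot, mul_zero]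
    rw [mul_sub, mul_one, sub_eq_zero] at hz
    exact hz.symm
  · intro he0
    have hu : aeval y a * aeval y ((X - C μ) ^ n) = 1 := by
      have h := hab'
      rw [he0, add_zero] at h
      exact h
    have hg0 : aeval y g = 0 := by
      have h := congrArg (aeval y a * ·) hPg
      simpa only [← mul_assoc, hu, one_mul, mul_zero] using h
    have hg_ne : g ≠ 0 := by
      rintro rfl
      exact hp0 (by rw [hpg, mul_zero])
    have h1 := natDegree_le_of_dvd (minpoly.dvd k y hg0) hg_ne
    have h2 : (minpoly k y).natDegree = n + g.natDegree := by
      rw [hpg, natDegree_mul (pow_ne_zero _ (X_sub_C_ne_zero μ)) hg_ne, natDegree_pow,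
        natDegree_X_sub_C, mul_one]
    omega
  · intro he1
    have hgb : aeval y g * aeval y b = 1 := by rw [← map_mul, mul_comm g b, he1]
    have hP0 : aeval y ((X - C μ) ^ n) = 0 := by
      have h := congrArg (· * aeval y b) hPg
      simpa only [mul_assoc, hgb, mul_one, zero_mul] using h
    exact hnl μ ⟨n, by rw [← hPy, hP0]⟩

end Idempotent

open MvPolynomial Matrix
open Literature.AlgebraicGeometry.DeterminantalHypersurfaces
open Summit.ValiantsHypothesis.ValiantsHypothesis.Theorems.EquivariantDialPairAlgebra

variable {k : Type*} [Field k] {σ : Type*}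

/-- A matrix whose intertwiner pair algebra is not local has an idempotent intertwiner pair
different from `0` and `1` (over an algebraically closed field). -/
theorem exists_idempotent_mem_pairAlg [IsAlgClosed k] {s : ℕ}
    {N : Matrix (Fin s) (Fin s) (MvPolynomial σ k)} (h : ¬ IsLocalRepr N) :
    ∃ e ∈ pairAlg N, IsIdempotentElem e ∧ e ≠ 0 ∧ e ≠ 1 := by
  unfold IsLocalRepr at h
  push Not at h
  obtain ⟨y, hy, hnl⟩ := h
  exact exists_idempotent_of_not_local (pairAlg N) hy hnl

/-- The two components of an intertwiner pair of a matrix with nonzero determinant have equal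
traces: from `C(e.1) N = N C(e.2)` one gets `det N · C(tr e.1) = det N · C(tr e.2)` by
multiplying with `adj N` and taking traces. -/
theorem trace_fst_eq_trace_snd {s : ℕ} {N : Matrix (Fin s) (Fin s) (MvPolynomial σ k)}
    (hN : N.det ≠ 0) {e : Matrix (Fin s) (Fin s) k × Matrix (Fin s) (Fin s) k}
    (he : e ∈ pairAlg N) : e.1.trace = e.2.trace := by
  rw [mem_pairAlg] at he
  have h := congrArg (fun X : Matrix (Fin s) (Fin s) (MvPolynomial σ k) => (X * N.adjugate).trace)
    he
  have h1 : (e.1.map C * N * N.adjugate).trace = N.det * C e.1.trace := by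
    rw [Matrix.mul_assoc, Matrix.mul_adjugate, Matrix.mul_smul, Matrix.mul_one, Matrix.trace_smul,
      trace_map_C, smul_eq_mul]
  have h2 : (N * e.2.map C * N.adjugate).trace = N.det * C e.2.trace := by
    rw [Matrix.trace_mul_comm, ← Matrix.mul_assoc, Matrix.adjugate_mul, Matrix.smul_mul,
      Matrix.one_mul, Matrix.trace_smul, trace_map_C, smul_eq_mul]
  rw [h1, h2] at h
  exact C_injective σ k (mul_left_cancel₀ hN h)

/-- Bookkeeping: `T⁻¹ x T = y` gives `x = T y T⁻¹` for `T` invertible. -/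
theorem eq_conj_of_inv_mul_mul_eq {n : Type*} [Fintype n] [DecidableEq n] {R : Type*} [CommRing R]
    {T x y : Matrix n n R} (hT : IsUnit T.det) (h : T⁻¹ * x * T = y) : x = T * y * T⁻¹ := by
  rw [← h, Matrix.mul_assoc, Matrix.mul_assoc, Matrix.mul_nonsing_inv _ hT, Matrix.mul_one,
    ← Matrix.mul_assoc, Matrix.mul_nonsing_inv _ hT, Matrix.one_mul]

/-- **Idempotent splitting.** An idempotent intertwiner pair `e = (e₁, e₂)` of `N` (that is
`C(e₁) N = N C(e₂)`, `e² = e`) with `tr e₁ = tr e₂` and `e ≠ 0, 1` splits `N`: there are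
constant invertible `U, V` with `C(U) N C(V) = X₁ ⊕ X₂` (blocks placed along
`Fin q ⊕ Fin q' ≃ Fin d`, `q = tr e₁ > 0`, `q' > 0`).  Over a field of characteristic zero (the
ranks of `e₁, e₂` are read off from their traces).  ★ Labels: restricted-model lower bound,
inside the equivariance barrier; 0 S-currency; closes NO item; `DcPerSuperpolynomial` /
VP ≠ VNP untouched. -/
theorem exists_blockDiagonal_of_idempotent [CharZero k] {d : ℕ}
    (N : Matrix (Fin d) (Fin d) (MvPolynomial σ k))
    {e : Matrix (Fin d) (Fin d) k × Matrix (Fin d) (Fin d) k} (he : e ∈ pairAlg N)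
    (hid : IsIdempotentElem e) (htr : e.1.trace = e.2.trace) (h0 : e ≠ 0) (h1 : e ≠ 1) :
    ∃ (q q' : ℕ) (hq : q + q' = d) (U V : GL (Fin d) k)
      (X₁ : Matrix (Fin q) (Fin q) (MvPolynomial σ k))
      (X₂ : Matrix (Fin q') (Fin q') (MvPolynomial σ k)),
      (U : Matrix (Fin d) (Fin d) k).map C * N * (V : Matrix (Fin d) (Fin d) k).map C =
          Matrix.reindex (finSumFinEquiv.trans (finCongr hq)) (finSumFinEquiv.trans (finCongr hq))
            (fromBlocks X₁ 0 0 X₂) ∧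
        0 < q ∧ 0 < q' := by
  have hid1 : e.1 * e.1 = e.1 := by simpa only [Prod.fst_mul] using congrArg Prod.fst hid.eq
  have hid2 : e.2 * e.2 = e.2 := by simpa only [Prod.snd_mul] using congrArg Prod.snd hid.eq
  obtain ⟨q, q', hq, P, hP, hPA, htrq⟩ := exists_conj_eq_fromBlocks_of_idempotent e.1 hid1
  obtain ⟨q₂, q₂', hq₂, S, hS, hSB, htrq₂⟩ := exists_conj_eq_fromBlocks_of_idempotent e.2 hid2
  have hqq : q = q₂ := Nat.cast_injective (R := k) (by rw [htrq, htr, ← htrq₂])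
  subst hqq
  have hqq' : q' = q₂' := by omega
  subst hqq'
  set ε : Fin q ⊕ Fin q' ≃ Fin d := finSumFinEquiv.trans (finCongr hq)
  have hSB' : S⁻¹ * e.2 * S = Matrix.reindex ε ε (fromBlocks 1 0 0 0) := hSB
  have hPdet : IsUnit P.det := (Matrix.isUnit_iff_isUnit_det _).mp hP
  have hSdet : IsUnit S.det := (Matrix.isUnit_iff_isUnit_det _).mp hS
  refine ⟨q, q', hq, hP.unit⁻¹, hS.unit, ((P⁻¹.map C * N * S.map C).submatrix ε ε).toBlocks₁₁,
    ((P⁻¹.map C * N * S.map C).submatrix ε ε).toBlocks₂₂, ?_, ?_, ?_⟩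
  · -- the block equation
    rw [Matrix.coe_units_inv, IsUnit.unit_spec, IsUnit.unit_spec]
    rw [mem_pairAlg] at he
    set Pc : Matrix (Fin d) (Fin d) (MvPolynomial σ k) := P.map C with hPc
    set Pinv : Matrix (Fin d) (Fin d) (MvPolynomial σ k) := P⁻¹.map C with hPinv
    set Sc : Matrix (Fin d) (Fin d) (MvPolynomial σ k) := S.map C with hSc
    set Sinv : Matrix (Fin d) (Fin d) (MvPolynomial σ k) := S⁻¹.map C with hSinv
    have hPcPinv : Pc * Pinv = 1 := by
      rw [hPinv, hPc, ← Matrix.map_mul, Matrix.mul_nonsing_inv _ hPdet,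
        Matrix.map_one C (map_zero C) (map_one C)]
    have hScSinv : Sc * Sinv = 1 := by
      rw [hSinv, hSc, ← Matrix.map_mul, Matrix.mul_nonsing_inv _ hSdet,
        Matrix.map_one C (map_zero C) (map_one C)]
    set F : Matrix (Fin q ⊕ Fin q') (Fin q ⊕ Fin q') (MvPolynomial σ k) := fromBlocks 1 0 0 0
      with hF
    have hrF_A : Pinv * (e.1.map C) * Pc = Matrix.reindex ε ε F := by
      have := congrArg (fun X : Matrix (Fin d) (Fin d) k =>
        (X.map C : Matrix (Fin d) (Fin d) (MvPolynomial σ k))) hPA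
      simp only [Matrix.map_mul] at this
      rw [hPinv, hPc, this, hF, ← fromBlocks_one_zero_map_C]
      rfl
    have hrF_B : Sinv * (e.2.map C) * Sc = Matrix.reindex ε ε F := by
      have := congrArg (fun X : Matrix (Fin d) (Fin d) k =>
        (X.map C : Matrix (Fin d) (Fin d) (MvPolynomial σ k))) hSB'
      simp only [Matrix.map_mul] at this
      rw [hSinv, hSc, this, hF, ← fromBlocks_one_zero_map_C]
      rfl
    set N' : Matrix (Fin d) (Fin d) (MvPolynomial σ k) := Pinv * N * Sc with hN'
    set N'' : Matrix (Fin q ⊕ Fin q') (Fin q ⊕ Fin q') (MvPolynomial σ k) := N'.submatrix ε ε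
      with hN''
    have hsubF : ∀ X : Matrix (Fin q ⊕ Fin q') (Fin q ⊕ Fin q') (MvPolynomial σ k),
        (Matrix.reindex ε ε X).submatrix ε ε = X := fun X => by
      simp [Matrix.reindex_apply, Matrix.submatrix_submatrix]
    -- the conjugated projector commutes with `N'`
    have hcomm' : Matrix.reindex ε ε F * N' = N' * Matrix.reindex ε ε F := by
      rw [hN']
      conv_lhs => rw [← hrF_A]
      conv_rhs => rw [← hrF_B]
      calc Pinv * e.1.map C * Pc * (Pinv * N * Sc)
          = Pinv * (e.1.map C * ((Pc * Pinv) * N)) * Sc := by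
            simp only [Matrix.mul_assoc]
        _ = Pinv * (N * (Sc * Sinv) * e.2.map C) * Sc := by
            rw [hPcPinv, Matrix.one_mul, he, hScSinv, Matrix.mul_one]
        _ = Pinv * N * Sc * (Sinv * e.2.map C * Sc) := by
            simp only [Matrix.mul_assoc]
    have hcomm : F * N'' = N'' * F := by
      have h := congrArg (fun X : Matrix (Fin d) (Fin d) (MvPolynomial σ k) => X.submatrix ε ε)
        hcomm'
      rw [← Matrix.submatrix_mul_equiv (Matrix.reindex ε ε F) N' ε ε ε,
        ← Matrix.submatrix_mul_equiv N' (Matrix.reindex ε ε F) ε ε ε, hsubF F] at h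
      rw [hN'']
      exact h
    -- hence the off-diagonal blocks of `N''` vanish
    have h12 : N''.toBlocks₁₂ = 0 ∧ N''.toBlocks₂₁ = 0 := by
      rw [← fromBlocks_toBlocks N'', hF, fromBlocks_multiply, fromBlocks_multiply] at hcomm
      simp only [Matrix.one_mul, Matrix.zero_mul, Matrix.mul_one, Matrix.mul_zero, add_zero]
        at hcomm
      obtain ⟨-, h12, h21, -⟩ := fromBlocks_inj.mp hcomm
      exact ⟨h12, h21.symm⟩
    have hX : N'' = fromBlocks N''.toBlocks₁₁ 0 0 N''.toBlocks₂₂ := by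
      conv_lhs => rw [← fromBlocks_toBlocks N'', h12.1, h12.2]
    change N' = Matrix.reindex ε ε _
    rw [← hX, hN'', Matrix.reindex_apply, Matrix.submatrix_submatrix, Equiv.self_comp_symm,
      Matrix.submatrix_id_id]
  · -- `e ≠ 0` forces `q > 0`
    refine Nat.pos_of_ne_zero fun hq0 => h0 ?_
    subst hq0
    have hE : (fromBlocks 1 0 0 0 : Matrix (Fin 0 ⊕ Fin q') (Fin 0 ⊕ Fin q') k) = 0 := by
      ext (i | i) (j | j)
      · exact i.elim0
      · exact i.elim0
      · exact j.elim0
      · simp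
    have he1 : e.1 = 0 := by
      rw [eq_conj_of_inv_mul_mul_eq hPdet hPA, hE]
      simp
    have he2 : e.2 = 0 := by
      rw [eq_conj_of_inv_mul_mul_eq hSdet hSB', hE]
      simp
    exact Prod.ext he1 he2
  · -- `e ≠ 1` forces `q' > 0`
    refine Nat.pos_of_ne_zero fun hq0 => h1 ?_
    subst hq0
    have hE : (fromBlocks 1 0 0 0 : Matrix (Fin q ⊕ Fin 0) (Fin q ⊕ Fin 0) k) = 1 := by
      ext (i | i) (j | j)
      · simp [Matrix.one_apply]
      · exact j.elim0
      · exact i.elim0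
      · exact i.elim0
    have he1 : e.1 = 1 := by
      rw [eq_conj_of_inv_mul_mul_eq hPdet hPA, hE]
      simp [Matrix.mul_nonsing_inv _ hPdet]
    have he2 : e.2 = 1 := by
      rw [eq_conj_of_inv_mul_mul_eq hSdet hSB', hE]
      simp [Matrix.mul_nonsing_inv _ hSdet]
    exact Prod.ext he1 he2

end

end Summit.ValiantsHypothesis.ValiantsHypothesis.Theorems.EquivariantDialIdempotentSplitting
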